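import Literature.Probability.RandomPlanarGeometry.HexSAWBrickWallStrip
import HarnessLib

/-!
# Bridges of the honeycomb lattice inside a row strip of the brick wall:
# `b_N(ℍ) ≤ (2N+1) · B` and `B^{2j} ≤ c_{2jN}(S_{4N})` for odd `N`

Topic `Literature/Probability/RandomPlanarGeometry` (continues `HexSAWBrickWallStrip.lean` — the row strips
`S_T = ℤ × {0,…,T}` of the brick wall, `HexBW.stripCount T N = c_N(S_T)` — and `HexSAWBrickWallBridges.lean` —
the brick-wall bridges `HexBW.bridges N` by the height `x₀` (Madras–Slade Definition 1.2.4), `b_N(ℍ)`, and the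
twisted concatenation `HexBW.concat`, `b_m b_n ≤ b_{m+n}`).  Source: N. Madras, G. Slade, *The Self-Avoiding
Walk* (1993), §8.2, proof of Theorem 8.2.1, p. 269–270 ("we can use this to show `lim_{T→∞} μ⟨T⟩ = μ`: …
concatenating bridges … every such concatenation lies in the tube"), transplanted from `ℤ^d` (tree
`SAWTubeBridges.lean`: height classes, pigeonhole, reflection pairs, level bridges) to the honeycomb lattice
in brick-wall coordinates.

## The mechanism on `ℍ` (what replaces the vertical reflection of `ℤ^d`)

The brick wall has NO automorphism fixing the origin and reversing the rows (the origin has a vertical bond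
upwards and none downwards), so the `ℤ^d` device "pair a bridge of the end-row class `h` with the REFLECTION
of another one" is not available letter by letter.  It is replaced by the PARITY TWIST of
`HexSAWBrickWallBridges.lean`: after an ODD number `N` of steps a walk from the origin sits at a site of odd
parity, and the tree's concatenation `HexBW.concat N ω υ` places the second bridge there through
`negY : (x, y) ↦ (x, −y)` — which IS the row reversal.  Hence for odd `N` two bridges `ω, υ` of the same end-row
class `h` concatenate to a `2N`-step bridge ending on the starting row (`h − h = 0`), all of whose sites are
within `2N` rows of the start; `2N` being even, such blocks then concatenate by plain translation, stay
within `2N` rows of the starting row for ever, and — started on row `2N` — lie in `S_{4N}`.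

## Contents (namespace `Literature.Probability.RandomPlanarGeometry.SAW.HexBW`, all PROVED)

* `rowOffsets N = {−N,…,N}`, `rowClass N h` (the `N`-step bridges ending on row `h`), `levelBridges W M`
  (the `M`-step bridges ending on row `0` with all sites within `W` rows of the start);
* `exists_rowClass` — pigeonhole: `b_N(ℍ) ≤ (2N+1) · #rowClass N h` for some `h`;
* `concat_injOn` — the twisted concatenation is injective in the two pieces;
* `sq_card_rowClass_le` — `(#rowClass N h)² ≤ #levelBridges 2N 2N` for ODD `N` (the parity twist);
* `card_levelBridges_mul_le`, `card_levelBridges_pow_le` (even lengths), `card_levelBridges_le_stripCount`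
  (`#levelBridges W M ≤ c_M(S_{2W})`);
* **`exists_pow_le_stripCount`** — for odd `N` some `B` has `b_N(ℍ) ≤ (2N+1) B` and `B^{2j} ≤ c_{2jN}(S_{4N})`
  for all `j` (the counting inequality behind (8.2.14) on `ℍ`).
-/

noncomputable section

open Finset Literature.Probability.LatticeModels Literature.Probability.Percolation SimpleGraph

namespace Literature.Probability.RandomPlanarGeometry.SAW.HexBW

/-! ### The parity twist and the twisted concatenation: small bookkeeping -/

/-- At a site of even parity the twist is the identity. [cite: EntingJensen2009, §7.4.2, Fig. 7.10 (brickwork form of the honeycomb lattice)] -/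
theorem twistAt_of_even {p : Site 2} (hp : (p 0 + p 1) % 2 = 0) (z : Site 2) : twistAt p z = z :=
  if_pos hp

/-- At a site of odd parity the twist is the row reversal `negY`. [cite: EntingJensen2009, §7.4.2, Fig. 7.10 (brickwork form of the honeycomb lattice)] -/
theorem twistAt_of_odd {p : Site 2} (hp : (p 0 + p 1) % 2 ≠ 0) (z : Site 2) : twistAt p z = negY z :=
  if_neg hp

/-- The twist preserves the distance to the starting row. [cite: EntingJensen2009, §7.4.2, Fig. 7.10 (brickwork form of the honeycomb lattice)] -/
theorem abs_twistAt_apply_one (p z : Site 2) : |twistAt p z 1| = |z 1| := by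
  unfold twistAt
  split_ifs
  · rfl
  · rw [negY_apply_one, abs_neg]

/-- Values of `concat` up to the gluing time. [cite: MadrasSlade1993, §1.2, eq. (1.2.15)] -/
theorem concat_apply_of_le {m i : ℕ} (ω υ : ℕ → Site 2) (hi : i ≤ m) : concat m ω υ i = ω i :=
  if_pos hi

/-- Values of `concat` after the gluing time (the second piece, twisted at `ω m` and translated there).
[cite: MadrasSlade1993, §1.2, eq. (1.2.15)] -/
theorem concat_apply_add {m : ℕ} (ω υ : ℕ → Site 2) (h0 : υ 0 = 0) (j : ℕ) :
    concat m ω υ (m + j) = ω m + twistAt (ω m) (υ j) := by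
  rcases Nat.eq_zero_or_pos j with rfl | hj
  · rw [h0, twistAt_zero, add_zero, add_zero, concat_apply_of_le ω υ le_rfl]
  · have h : ¬ m + j ≤ m := by omega
    simp only [concat, Zd.concatWalk, if_neg h, Nat.add_sub_cancel_left]

/-- **The twisted concatenation is injective in the two pieces** (walks frozen after their lengths).
[cite: MadrasSlade1993, §1.2, eq. (1.2.15)] -/
theorem concat_injective_pieces {m t t' : ℕ} {ω υ ω' υ' : ℕ → Site 2} (hω : ω ∈ Zd.saws 2 m)
    (hυ : υ ∈ Zd.saws 2 t) (hω' : ω' ∈ Zd.saws 2 m) (hυ' : υ' ∈ Zd.saws 2 t')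
    (h : concat m ω υ = concat m ω' υ') : ω = ω' ∧ υ = υ' := by
  have hωs := Zd.mem_saws.1 hω
  have hυs := Zd.mem_saws.1 hυ
  have hω's := Zd.mem_saws.1 hω'
  have hυ's := Zd.mem_saws.1 hυ'
  have hm : ω m = ω' m := by
    have := congrFun h m
    rwa [concat_apply_of_le ω υ le_rfl, concat_apply_of_le ω' υ' le_rfl] at this
  have h1 : ω = ω' := funext fun i => (le_or_gt i m).elim
    (fun hi => by simpa only [concat_apply_of_le _ _ hi] using congrFun h i)
    fun hi => by rw [hωs.2.1 i hi.le, hω's.2.1 i hi.le, hm]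
  refine ⟨h1, funext fun j => ?_⟩
  have := congrFun h (m + j)
  rw [concat_apply_add ω υ hυs.1, concat_apply_add ω' υ' hυ's.1, hm, add_right_inj] at this
  exact twistAt_injective _ this

/-! ### Row classes of bridges, level bridges -/

/-- The possible end rows of an `N`-step walk from the origin: `{−N,…,N}`. [cite: MadrasSlade1993, §8.2] -/
def rowOffsets (N : ℕ) : Finset ℤ := Finset.Icc (-(N : ℤ)) N

open Classical in
/-- The class of `N`-step brick-wall bridges whose endpoint is on row `h`.
[cite: MadrasSlade1993, §8.2, proof of Theorem 8.2.1] -/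
def rowClass (N : ℕ) (h : ℤ) : Finset (ℕ → Site 2) := (bridges N).filter fun ω => ω N 1 = h

open Classical in
/-- The **level bridges**: `M`-step brick-wall bridges from `0` ending on row `0` all of whose sites are
within `W` rows of the start (the printed `𝓑_M⟨T⟩` up to a vertical translation).
[cite: MadrasSlade1993, §8.2, proof of Theorem 8.2.1] -/
def levelBridges (W M : ℕ) : Finset (ℕ → Site 2) :=
  (bridges M).filter fun ω => ω M 1 = 0 ∧ ∀ m ≤ M, |ω m 1| ≤ W

/-- `#rowOffsets N = 2N+1`. [cite: MadrasSlade1993, §8.2] -/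
theorem card_rowOffsets (N : ℕ) : (rowOffsets N).card = 2 * N + 1 := by
  rw [rowOffsets, Int.card_Icc]
  omega

/-- Membership in `rowClass`. [cite: MadrasSlade1993, §8.2] -/
theorem mem_rowClass {N : ℕ} {h : ℤ} {ω : ℕ → Site 2} : ω ∈ rowClass N h ↔ ω ∈ bridges N ∧ ω N 1 = h := by
  classical
  exact Finset.mem_filter

/-- Membership in `levelBridges`. [cite: MadrasSlade1993, §8.2] -/
theorem mem_levelBridges {W M : ℕ} {ω : ℕ → Site 2} :
    ω ∈ levelBridges W M ↔ ω ∈ bridges M ∧ ω M 1 = 0 ∧ ∀ m ≤ M, |ω m 1| ≤ W := by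
  classical
  exact Finset.mem_filter

/-- After `m ≤ N` steps a walk from the origin is within `m` rows of the start.
[cite: MadrasSlade1993, §1.1] -/
theorem abs_apply_one_le {N : ℕ} {ω : ℕ → Site 2} (hω : ω ∈ saws N) {m : ℕ} (hm : m ≤ N) :
    |ω m 1| ≤ (m : ℤ) := by
  obtain ⟨h0, -, hadj, -⟩ := Zd.mem_saws.1 (saws_subset N hω)
  exact Zd.abs_apply_le_of_adj h0 hadj m hm 1

/-- The end row of an `N`-step bridge lies in `rowOffsets N`. [cite: MadrasSlade1993, §8.2] -/
theorem apply_one_mem_rowOffsets {N : ℕ} {ω : ℕ → Site 2} (hω : ω ∈ bridges N) : ω N 1 ∈ rowOffsets N := by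
  rw [rowOffsets, Finset.mem_Icc]
  exact abs_le.1 (abs_apply_one_le (mem_bridges.1 hω).1 le_rfl)

/-- **Pigeonhole**: some row class contains at least `b_N(ℍ)/(2N+1)` of the `b_N(ℍ)` bridges.
[cite: MadrasSlade1993, §8.2, proof of Theorem 8.2.1] -/
theorem exists_rowClass (N : ℕ) : ∃ h ∈ rowOffsets N, bridgeCount N ≤ (2 * N + 1) * (rowClass N h).card := by
  classical
  have hmaps : ∀ ω ∈ bridges N, ω N 1 ∈ rowOffsets N := fun ω hω => apply_one_mem_rowOffsets hω
  have hne : (rowOffsets N).Nonempty := ⟨0, by simp [rowOffsets]⟩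
  obtain ⟨h, hh, hmax⟩ := Finset.exists_max_image (rowOffsets N) (fun h => (rowClass N h).card) hne
  refine ⟨h, hh, ?_⟩
  rw [bridgeCount, Finset.card_eq_sum_card_fiberwise hmaps, ← card_rowOffsets N]
  calc ∑ b ∈ rowOffsets N, ((bridges N).filter fun ω => ω N 1 = b).card
      ≤ ∑ _b ∈ rowOffsets N, (rowClass N h).card := by
        refine Finset.sum_le_sum fun b hb => ?_
        have := hmax b hb
        rw [rowClass] at this
        convert this using 2
    _ = (rowOffsets N).card * (rowClass N h).card := by rw [Finset.sum_const, smul_eq_mul]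

/-! ### Odd `N`: two bridges of one row class give a level bridge (the parity twist) -/

/-- **`(#rowClass N h)² ≤ #levelBridges 2N 2N` for odd `N`**: `(ω, υ) ↦ concat N ω υ` is injective from pairs
of bridges of the row class `h` to `2N`-step bridges ending on row `h − h = 0` (the endpoint `ω N` has odd
parity, so the second piece is placed through `negY`) whose sites are within `2N` rows of the start.
[cite: MadrasSlade1993, §8.2, proof of Theorem 8.2.1] -/
theorem sq_card_rowClass_le {N : ℕ} (hN : Odd N) (h : ℤ) :
    (rowClass N h).card ^ 2 ≤ (levelBridges (N + N) (N + N)).card := by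
  rw [sq, ← Finset.card_product]
  refine Finset.card_le_card_of_injOn (fun p => concat N p.1 p.2) ?_ ?_
  · rintro ⟨ω, υ⟩ hp
    simp only [Finset.mem_coe, Finset.mem_product, mem_rowClass] at hp
    obtain ⟨⟨hω, hωe⟩, hυ, hυe⟩ := hp
    dsimp only
    have hωS := (mem_bridges.1 hω).1
    have hυS := (mem_bridges.1 hυ).1
    have hυ0 : υ 0 = 0 := (Zd.mem_saws.1 (saws_subset N hυS)).1
    -- the endpoint `ω N` has odd parity
    have hpar : (ω N 0 + ω N 1) % 2 ≠ 0 := by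
      rw [parity_apply hωS le_rfl]
      obtain ⟨k, rfl⟩ := hN
      push_cast
      omega
    rw [Finset.mem_coe, mem_levelBridges]
    refine ⟨concat_mem_bridges hω hυ, ?_, ?_⟩
    · rw [concat_apply_add ω υ hυ0 N, Pi.add_apply, twistAt_of_odd hpar, negY_apply_one, hωe, hυe,
        add_neg_cancel]
    · intro m hm
      by_cases hle : m ≤ N
      · rw [concat_apply_of_le _ _ hle]
        have := abs_apply_one_le hωS hle
        push_cast
        omega
      · obtain ⟨j, rfl⟩ : ∃ j, m = N + j := ⟨m - N, by omega⟩
        rw [concat_apply_add _ _ hυ0, Pi.add_apply]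
        have h1 := abs_apply_one_le hωS (le_refl N)
        have h2 : |twistAt (ω N) (υ j) 1| ≤ (j : ℤ) := by
          rw [abs_twistAt_apply_one]
          exact abs_apply_one_le hυS (by omega)
        have h3 : (j : ℤ) ≤ N := by exact_mod_cast (show j ≤ N by omega)
        calc |ω N 1 + twistAt (ω N) (υ j) 1| ≤ |ω N 1| + |twistAt (ω N) (υ j) 1| := abs_add_le _ _
          _ ≤ N + N := add_le_add h1 (h2.trans h3)
          _ = ((N + N : ℕ) : ℤ) := by push_cast; ring
  · rintro ⟨ω, υ⟩ hp ⟨ω', υ'⟩ hp' hh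
    simp only [Finset.mem_coe, Finset.mem_product, mem_rowClass] at hp hp'
    dsimp only at hh
    have hs := saws_subset N (mem_bridges.1 hp.1.1).1
    have hs' := saws_subset N (mem_bridges.1 hp'.1.1).1
    have ht := saws_subset N (mem_bridges.1 hp.2.1).1
    have ht' := saws_subset N (mem_bridges.1 hp'.2.1).1
    obtain ⟨h1, h2⟩ := concat_injective_pieces hs ht hs' ht' hh
    simp only [Prod.mk.injEq]
    exact ⟨h1, h2⟩

/-! ### Even lengths: level bridges concatenate by translation and lie in the strip -/

/-- Level bridges of EVEN length concatenate: `#L(W,M) · #L(W,M') ≤ #L(W,M+M')` (the endpoint of the first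
piece has even parity, so the second piece is translated, starts on row `0` again, and all sites stay within
`W` rows). [cite: MadrasSlade1993, §8.2, proof of Theorem 8.2.1] -/
theorem card_levelBridges_mul_le (W : ℕ) {M : ℕ} (hM : Even M) (M' : ℕ) :
    (levelBridges W M).card * (levelBridges W M').card ≤ (levelBridges W (M + M')).card := by
  rw [← Finset.card_product]
  refine Finset.card_le_card_of_injOn (fun p => concat M p.1 p.2) ?_ ?_
  · rintro ⟨ω, υ⟩ hp
    simp only [Finset.mem_coe, Finset.mem_product, mem_levelBridges] at hp
    obtain ⟨⟨hω, hωe, hωW⟩, hυ, hυe, hυW⟩ := hp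
    dsimp only
    have hωS := (mem_bridges.1 hω).1
    have hυS := (mem_bridges.1 hυ).1
    have hυ0 : υ 0 = 0 := (Zd.mem_saws.1 (saws_subset M' hυS)).1
    -- the endpoint `ω M` has even parity
    have hpar : (ω M 0 + ω M 1) % 2 = 0 := by
      rw [parity_apply hωS le_rfl]
      obtain ⟨k, rfl⟩ := hM
      push_cast
      omega
    rw [Finset.mem_coe, mem_levelBridges]
    refine ⟨concat_mem_bridges hω hυ, ?_, ?_⟩
    · rw [concat_apply_add ω υ hυ0 M', Pi.add_apply, twistAt_of_even hpar, hωe, hυe, add_zero]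
    · intro m hm
      by_cases hle : m ≤ M
      · rw [concat_apply_of_le _ _ hle]
        exact hωW m hle
      · obtain ⟨j, rfl⟩ : ∃ j, m = M + j := ⟨m - M, by omega⟩
        rw [concat_apply_add _ _ hυ0, Pi.add_apply, twistAt_of_even hpar, hωe, zero_add]
        exact hυW j (by omega)
  · rintro ⟨ω, υ⟩ hp ⟨ω', υ'⟩ hp' hh
    simp only [Finset.mem_coe, Finset.mem_product, mem_levelBridges] at hp hp'
    dsimp only at hh
    obtain ⟨h1, h2⟩ := concat_injective_pieces (saws_subset M (mem_bridges.1 hp.1.1).1)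
      (saws_subset M' (mem_bridges.1 hp.2.1).1) (saws_subset M (mem_bridges.1 hp'.1.1).1)
      (saws_subset M' (mem_bridges.1 hp'.2.1).1) hh
    simp only [Prod.mk.injEq]
    exact ⟨h1, h2⟩

/-- The `0`-step walk is a level bridge. [cite: MadrasSlade1993, §8.2] -/
theorem straightWalk_zero_mem_levelBridges (W : ℕ) : Zd.straightWalk 2 0 ∈ levelBridges W 0 := by
  refine mem_levelBridges.2 ⟨straightWalk_mem_bridges 0, ?_, fun m _ => ?_⟩
  · simp [Zd.straightWalk]
  · simp [Zd.straightWalk]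

/-- `#L(W,M)^j ≤ #L(W, jM)` for even `M`. [cite: MadrasSlade1993, §8.2, proof of Theorem 8.2.1] -/
theorem card_levelBridges_pow_le (W : ℕ) {M : ℕ} (hM : Even M) (j : ℕ) :
    (levelBridges W M).card ^ j ≤ (levelBridges W (j * M)).card := by
  induction j with
  | zero =>
    rw [pow_zero, zero_mul]
    exact Finset.card_pos.2 ⟨_, straightWalk_zero_mem_levelBridges W⟩
  | succ j ih =>
    calc (levelBridges W M).card ^ (j + 1) = (levelBridges W M).card ^ j * (levelBridges W M).card := pow_succ _ _
      _ ≤ (levelBridges W (j * M)).card * (levelBridges W M).card := Nat.mul_le_mul_right _ ih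
      _ ≤ (levelBridges W (j * M + M)).card := card_levelBridges_mul_le W (hM.mul_left j) M
      _ = (levelBridges W ((j + 1) * M)).card := by rw [Nat.succ_mul]

/-- The starting site on row `W` of the cross-section with EVEN parity: `(W mod 2, W)`.
[cite: MadrasSlade1993, §8.2, proof of Theorem 8.2.1, eq. (8.2.14)] -/
def midStart (W : ℕ) : Site 2 := fun i => if i = 0 then (W : ℤ) % 2 else W

/-- Coordinates of `midStart`. [cite: MadrasSlade1993, §8.2] -/
@[simp] theorem midStart_apply_zero (W : ℕ) : midStart W 0 = (W : ℤ) % 2 := rfl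

/-- Coordinates of `midStart`. [cite: MadrasSlade1993, §8.2] -/
@[simp] theorem midStart_apply_one (W : ℕ) : midStart W 1 = W := if_neg (by decide)

/-- `midStart W` is a starting site of `S_{2W}`. [cite: MadrasSlade1993, §8.2, eq. (8.2.1)] -/
theorem midStart_mem_stripStarts (W : ℕ) : midStart W ∈ stripStarts (2 * W) := by
  refine mem_stripStarts.2 ⟨⟨?_, ?_⟩, ?_, ?_⟩
  · rw [midStart_apply_zero]; omega
  · rw [midStart_apply_zero]; omega
  · rw [midStart_apply_one]; positivity
  · rw [midStart_apply_one]; push_cast; linarith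

/-- `midStart W` has even parity. [cite: EntingJensen2009, §7.4.2, Fig. 7.10 (brickwork form of the honeycomb lattice)] -/
theorem midStart_even (W : ℕ) : (midStart W 0 + midStart W 1) % 2 = 0 := by
  rw [midStart_apply_zero, midStart_apply_one]
  omega

/-- Level bridges started on row `W` (at the even site `midStart W`) lie in the strip `S_{2W}`:
`#L(W,M) ≤ c_M(S_{2W})`. [cite: MadrasSlade1993, §8.2, proof of Theorem 8.2.1, eq. (8.2.14)] -/
theorem card_levelBridges_le_stripCount (W M : ℕ) : (levelBridges W M).card ≤ stripCount (2 * W) M := by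
  refine Finset.card_le_card_of_injOn (fun ω => (midStart W, ω)) ?_ ?_
  · intro ω hω
    rw [Finset.mem_coe, mem_levelBridges] at hω
    obtain ⟨hω, -, hW⟩ := hω
    have hωS := (mem_bridges.1 hω).1
    obtain ⟨hZ, hbw⟩ := mem_saws.1 hωS
    rw [Finset.mem_coe, mem_stripPairs]
    refine ⟨midStart_mem_stripStarts W, hZ, fun i hi => ?_, fun m hm => ?_⟩
    · exact (adj_add_left_iff_of_even (midStart_even W) _ _).2 (hbw i hi)
    · have := abs_le.1 (hW m hm)
      refine ⟨?_, ?_⟩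
      · simp only [Pi.add_apply, midStart_apply_one]
        linarith [this.1]
      · simp only [Pi.add_apply, midStart_apply_one]
        push_cast
        linarith [this.2]
  · intro ω _ ω' _ hh
    simpa using hh

/-- **The counting inequality on `ℍ`**: for every ODD `N` there is a class size `B` with `b_N(ℍ) ≤ (2N+1) · B`
and `B^{2j} ≤ c_{2jN}(S_{4N})` for all `j`. [cite: MadrasSlade1993, §8.2, proof of Theorem 8.2.1, eq. (8.2.14)] -/
theorem exists_pow_le_stripCount {N : ℕ} (hN : Odd N) :
    ∃ B : ℕ, bridgeCount N ≤ (2 * N + 1) * B ∧ ∀ j : ℕ, B ^ (2 * j) ≤ stripCount (4 * N) (j * (2 * N)) := by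
  obtain ⟨h, -, hh⟩ := exists_rowClass N
  refine ⟨(rowClass N h).card, hh, fun j => ?_⟩
  have hev : Even (N + N) := ⟨N, rfl⟩
  calc (rowClass N h).card ^ (2 * j)
      = ((rowClass N h).card ^ 2) ^ j := by rw [pow_mul]
    _ ≤ (levelBridges (N + N) (N + N)).card ^ j := Nat.pow_le_pow_left (sq_card_rowClass_le hN h) j
    _ ≤ (levelBridges (N + N) (j * (N + N))).card := card_levelBridges_pow_le _ hev j
    _ ≤ stripCount (2 * (N + N)) (j * (N + N)) := card_levelBridges_le_stripCount _ _
    _ = stripCount (4 * N) (j * (2 * N)) := by ring_nf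

end Literature.Probability.RandomPlanarGeometry.SAW.HexBW
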